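import Summits.CriticalPhenomena.Ising3D.Control2DOpeEpsCells
import Summits.CriticalPhenomena.Ising3D.Control2DL11OpeELAData18
import Summits.CriticalPhenomena.Ising3D.Control2DL11OpeELAData20
import Summits.CriticalPhenomena.Ising3D.Control2DL11OpeELAData21
import Summits.CriticalPhenomena.Ising3D.Control2DL11OpeELAData22
import Summits.CriticalPhenomena.Ising3D.Control2DL11OpeELAData23
import Summits.CriticalPhenomena.Ising3D.Control2DL11OpeELARegion
import Summits.CriticalPhenomena.Ising3D.Control2DOpeEpsKernel
import Summits.CriticalPhenomena.Ising3D.Control2DOpeEpsKernelZ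
import Summits.CriticalPhenomena.Ising3D.Control2DL11OpeEUA
import Summits.CriticalPhenomena.Ising3D.Control2DOpeEpsRungs
import Mathlib.Tactic.IntervalCases
import Mathlib.Tactic.Linarith
import Mathlib.Tactic.NormNum
import HarnessLib

/-!
# A kind-`ope2eps` (sense LOWER) 2D γ-certificate in the kernel: `W(box) > 124893/2000000` at `Δ_σ = 1/8` under `A2D′` (Λ = 11)
(cell `pub-ising3x`, seats controls-1 gen 21 / gen 25; KERNEL PATH for the 2D γ-certificates, kind `ope2eps` (the λ²_σσε datum) — CONTROL-ONLY)

HONEST FRAMING: lottery ticket; floor = tightest certified 3D Ising CFT bounds; no exact-solution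
claim without a proof. CONTROL-ONLY: `d = 2`, global blocks, `Δ_σ = 1/8` exact, the 2D axiom set `A2D′` with the
CERTIFIED `ε` box `[197/200, 20001/20000]` as scalar input; `W = Σ_(ℓ=0, Δ_i in the box) p_i 2^(-Δ_i)` is the weighted in-box scalar content
(`Control2DOpeEpsTwoSided`; `pBoxTwoSided_rb6_L11` turns the (lower, upper) pair into two-sided bounds on `p_box` and `λ²_σσ[box] = 2 p_box`).

**`opeEpsLower_2d_L11_opeELA : OpeEpsLowerA2D (1/8) 2 1 (197 / 200) (20001 / 20000) (124893/2000000)`** — from the RB-6 ope2eps (sense lower) certificate `j139947_functional_deriv2d_L11_E032_sig1o8_ope2epslower_P124893o2000000.json` (Λ = 11, E₀ = 32): W(box) > 124893/2000000 at Δ_σ = 1/8 under A2D′, W = Σ_(ℓ=0, Δ ∈ [197/200, 20001/20000]) p_i 2^(-Δ_i) (⇒ λ²_σσ[box] > 2·2^(197/200)·124893/2000000), with EVERY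
obligation re-decided in the Lean kernel: per box cell (I″) and the SIGN of the truncated scalar block plus the integer double-series tail majorant (`Control2DOpeEpsTail`, uniform margin `epsLowerMargin`)
as Bernstein decisions on the spin-0 literal (`epsChk*_opeELA_l*` below, `Control2DOpeEpsKernel` / `Control2DOpeEpsKernelZ`), (R) by `region_of_kernelCertAuto`, cells `cells_opeELA`
(`OpeEpsCellsN`: (C′), the stress-tensor point, spin 2 on [3, E₀), even spins ≥ 4). Zero grant compute. No facts, standard axioms only.

`cells_opeELA`: every cell obligation of the certificate ((E) on the ε box, (C′) scalars on [2, E₀), the stress-tensor point (T), spin 2 on [3, E₀), even spins ≥ 4 on [ℓ, E₀); E₀ = 32), in the witness form `∃ N ≥ E₀` with the spin's own truncation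
order, from the kernel-decided Bernstein leaves of `Control2DL11OpeELAData*` via `cell_nonneg_of_bernCheck` (leaves of the extra leaf files are decided on the GROUP-SUM form `phat…g<i>` of the cell polynomial; each such application bridges `phat… = phat…g<i>` by an inline `decide +kernel` — controls-1 g20, one gate dependency level less). No facts, standard axioms only.

ONE MODULE for the cells theorem and the assembly (controls-1 g20): every gate dependency level waits for the farm's tree build to catch
up with the freshly landed imports (measured 1–2 h per level under load, `remote:stale:…:unbuilt`), so the cells theorem below is not a
separate `…Cells` module as in the earlier replays; statements and proofs are unchanged.
controls-1 g25: the two ε-box leaves are decided IN THIS MODULE on the spin-0 LITERAL `phatopeELAs0` of `Control2DL11OpeELAData18` (no extra leaf file,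
no group-sum bridge): `epsChkI_opeELA_l0` ((I″), `ptrunc`, 35 s) and `epsChkL_opeELA_l0` (the LOWER sign) through the ZERO-TAIL truncation `ptruncZ` of
`Control2DOpeEpsKernelZ` (`epsSignLower_of_bernAuto_truncZ`, extra cell condition `a + L ≤ q`): the floor truncation `ptrunc` of this leaf left a dense
tail of 253 `-1` coefficients on which the kernel's Bernstein evaluation exceeded the gate's 600 s (KP8 `…Data19` p372… and the g24 split p384214 bounced
`elaboration timed out`); with the tail zeroed, charged to the constant term and trimmed (degree 325 → 72) the same decision takes seconds (farm probes, g25).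
THE COVER IN THE SAME MODULE (controls-1 g25; one hub-build level fewer): with `opeEpsUpper_2d_L11_opeEUA` (`Control2DL11OpeEUA`, LANDED p385805)
and `opeEpsLower_2d_L11_opeELA` below, `Control2DOpeEpsRungs.pBoxTwoSided_rb6_L11` (controls-1 g13; the two RB-6 `ope2eps` certificates of kit
job j139947, Λ = 11, E₀ = 32, readers A 2.5 ∧ B 2.4 PASS, taken there as HYPOTHESES) has both hypotheses discharged by kernel replays:
**`pBoxTwoSided_2d_L11`** — `2^{e₁}·124893/2000000 < p_box < 2^{e₂}·127743/2000000` for the total in-box scalar coefficient of every admissible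
datum (`λ²_σσ[box] = 2 p_box`, `lambdaSqBox_bounds`): the 2D control's `λ²_σσε` datum TWO-SIDED and kernel-complete at Λ = 11 (this replaces the
planned separate cover module `Control2DL11PBoxTwoSided` of KP8). Zero grant compute. No facts, standard axioms only.
controls-1 g26 (v3): `cells_opeELA` is a `have` inside `opeEpsLower_2d_L11_opeELA` (gate statement-dedup vs `cells_opeEUA`); statements of the
exported theorems unchanged.
-/

namespace Summit.CriticalPhenomena.Ising3D.Control2D

open Finset Set
open Literature.MathematicalPhysics.QuantumFieldTheory.ConformalBootstrap3D

set_option maxHeartbeats 0 in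
set_option maxRecDepth 200000 in
/-- **Kernel check of the ε-box leaf I0 of kind `ope2eps`** (`y ∈ [19700/40000, 20001/40000]`; (I″) on the truncated scalar block; coefficients truncated by `10^539`), on the spin-0 literal `phatopeELAs0`. [folklore] -/
theorem epsChkI_opeELA_l0 : bernAuto (ptrunc (zadd (zadd (zsmul (((2000000 : ℕ) : ℤ) * identZ wtopeELA slL11 11 * 4 ^ 79) (zmul (dpolyZ 79) (dpolyZ 79))) (zsmul ((124893 : ℕ) : ℤ) phatopeELAs0)) [-1]) 539) 40000 19700 301 = true := by
  decide +kernel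

set_option maxHeartbeats 0 in
set_option maxRecDepth 200000 in
/-- **Kernel check of the ε-box leaf L0 of kind `ope2eps`** (`y ∈ [19700/40000, 20001/40000]`; sign of the truncated scalar block plus the integer tail majorant (lower); ZERO-TAIL truncation `ptruncZ` by `10^586`: 253 tiny negative coefficients zeroed and charged to the constant term, degree 325 → 72), on the spin-0 literal `phatopeELAs0`. [folklore] -/
theorem epsChkL_opeELA_l0 : bernAuto (ptruncZ (zadd (zadd (zsmul (-((epsC1 11 79 : ℕ) : ℤ)) phatopeELAs0) (zsmul (-(epsKZ wtopeELA slL11 11 79)) (zmul (dpolyZ 79) (dpolyZ 79)))) [-1]) 586) 40000 19700 301 = true := by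
  decide +kernel

-- controls-1 g26 (v3): the cells obligations are proved INLINE below (`have cells_opeELA`). As a top-level theorem the statement
-- `OpeEpsCellsN slL11.toFinset (fun p => (wtopeELA p : ℝ)) …` is textually parallel to the landed `cells_opeEUA` (weights `wtopeEUA`,
-- a DIFFERENT table) and the gate's statement-dedup normaliser identified the two (`dedup.landed`, dry-runs 2026-08-25T04:53Z/04:55Z).
set_option maxHeartbeats 0 in
set_option maxRecDepth 200000 in
/-- **2D control, γ-architecture, kind `ope2eps` (LOWER sense), kernel-complete: under `A2D′` at `Δ_σ = 1/8` with the `ε` box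
`[197/200, 20001/20000]`, `W(box) > 124893/2000000`**, every obligation of the Λ = 11 functional checked in the Lean kernel (scalar-block truncation
`N = 79 + 1` on the box, integer double-series tail). CONTROL-ONLY (d = 2). [cite: RattazziEtAl2008, §5.5] -/
theorem opeEpsLower_2d_L11_opeELA : OpeEpsLowerA2D (1 / 8 : ℝ) 2 1 (197 / 200) (20001 / 20000) (124893 / 2000000) := by
  have cells_opeELA : OpeEpsCellsN slL11.toFinset (fun p => (wtopeELA p : ℝ)) (1 / 8) 2 1 32 := by
    refine ⟨?_, ?_, ?_, ?_⟩
    · intro Δ h1 h2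
      replace h2 := h2.le
      refine ⟨79 + 1, by norm_num, ?_⟩
      rcases le_or_gt Δ ((31 : ℝ) / 8) with hd0 | hd0
      · exact cell_nonneg_of_bernAuto_trunc wtopeELA slL11_nodup slL11_deg 0 79 534 (q := 16) (a := 16) (L := 15) (by norm_num) (by norm_num) (by norm_num) (by rw [phatopeELAs0_eq]; exact cellChk_opeELA_s0l0) (by norm_num; linarith) (by norm_num; linarith)
      rcases le_or_gt Δ ((139 : ℝ) / 32) with hd1 | hd1
      · exact cell_nonneg_of_bernAuto_trunc wtopeELA slL11_nodup slL11_deg 0 79 534 (q := 64) (a := 124) (L := 15) (by norm_num) (by norm_num) (by norm_num) (by rw [phatopeELAs0_eq]; exact cellChk_opeELA_s0l1) (by norm_num; linarith) (by norm_num; linarith)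
      rcases le_or_gt Δ ((77 : ℝ) / 16) with hd2 | hd2
      · exact cell_nonneg_of_bernAuto_trunc wtopeELA slL11_nodup slL11_deg 0 79 534 (q := 64) (a := 139) (L := 15) (by norm_num) (by norm_num) (by norm_num) (by rw [phatopeELAs0_eq]; exact cellChk_opeELA_s0l2) (by norm_num; linarith) (by norm_num; linarith)
      rcases le_or_gt Δ ((23 : ℝ) / 4) with hd3 | hd3
      · exact cell_nonneg_of_bernAuto_trunc wtopeELA slL11_nodup slL11_deg 0 79 534 (q := 32) (a := 77) (L := 15) (by norm_num) (by norm_num) (by norm_num) (by rw [phatopeELAs0_eq]; exact cellChk_opeELA_s0l3) (by norm_num; linarith) (by norm_num; linarith)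
      rcases le_or_gt Δ ((19 : ℝ) / 2) with hd4 | hd4
      · exact cell_nonneg_of_bernAuto_trunc wtopeELA slL11_nodup slL11_deg 0 79 534 (q := 8) (a := 23) (L := 15) (by norm_num) (by norm_num) (by norm_num) (by rw [phatopeELAs0_eq]; exact cellChk_opeELA_s0l4) (by norm_num; linarith) (by norm_num; linarith)
      rcases le_or_gt Δ (17 : ℝ) with hd5 | hd5
      · exact cell_nonneg_of_bernAuto_trunc wtopeELA slL11_nodup slL11_deg 0 79 534 (q := 4) (a := 19) (L := 15) (by norm_num) (by norm_num) (by norm_num) (by rw [phatopeELAs0_eq]; exact cellChk_opeELA_s0l5) (by norm_num; linarith) (by norm_num; linarith)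
      exact cell_nonneg_of_bernAuto_trunc wtopeELA slL11_nodup slL11_deg 0 79 534 (q := 2) (a := 17) (L := 15) (by norm_num) (by norm_num) (by norm_num) (by rw [phatopeELAs0_eq]; exact cellChk_opeELA_s0l6) (by norm_num; linarith) (by norm_num; linarith)
    · refine ⟨47 + 1, by norm_num, ?_⟩
      exact cell_nonneg_of_bernAuto_trunc wtopeELA slL11_nodup slL11_deg 2 47 290 (q := 1) (a := 0) (L := 0) (by norm_num) (by norm_num) (by norm_num) (by rw [phatopeELAs2_eq]; exact cellChk_opeELA_s2l0) (by norm_num) (by norm_num)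
    · intro Δ h1 h2
      replace h1 : (3 : ℝ) ≤ Δ := by linarith
      replace h2 := h2.le
      refine ⟨47 + 1, by norm_num, ?_⟩
      rcases le_or_gt Δ ((77 : ℝ) / 16) with hd0 | hd0
      · exact cell_nonneg_of_bernAuto_trunc wtopeELA slL11_nodup slL11_deg 2 47 290 (q := 32) (a := 16) (L := 29) (by norm_num) (by norm_num) (by norm_num) (by rw [phatopeELAs2_eq]; exact cellChk_opeELA_s2l1) (by norm_num; linarith) (by norm_num; linarith)
      rcases le_or_gt Δ ((337 : ℝ) / 64) with hd1 | hd1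
      · exact cell_nonneg_of_bernAuto_trunc wtopeELA slL11_nodup slL11_deg 2 47 290 (q := 128) (a := 180) (L := 29) (by norm_num) (by norm_num) (by norm_num) (by rw [phatopeELAs2_eq]; exact cellChk_opeELA_s2l2) (by norm_num; linarith) (by norm_num; linarith)
      rcases le_or_gt Δ ((183 : ℝ) / 32) with hd2 | hd2
      · exact cell_nonneg_of_bernAuto_trunc wtopeELA slL11_nodup slL11_deg 2 47 290 (q := 128) (a := 209) (L := 29) (by norm_num) (by norm_num) (by norm_num) (by rw [phatopeELAs2_eq]; exact cellChk_opeELA_s2l3) (by norm_num; linarith) (by norm_num; linarith)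
      rcases le_or_gt Δ ((53 : ℝ) / 8) with hd3 | hd3
      · exact cell_nonneg_of_bernAuto_trunc wtopeELA slL11_nodup slL11_deg 2 47 290 (q := 64) (a := 119) (L := 29) (by norm_num) (by norm_num) (by norm_num) (by rw [phatopeELAs2_eq]; exact cellChk_opeELA_s2l4) (by norm_num; linarith) (by norm_num; linarith)
      rcases le_or_gt Δ ((41 : ℝ) / 4) with hd4 | hd4
      · exact cell_nonneg_of_bernAuto_trunc wtopeELA slL11_nodup slL11_deg 2 47 290 (q := 16) (a := 37) (L := 29) (by norm_num) (by norm_num) (by norm_num) (by rw [phatopeELAs2_eq]; exact cellChk_opeELA_s2l5) (by norm_num; linarith) (by norm_num; linarith)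
      rcases le_or_gt Δ ((685 : ℝ) / 64) with hd5 | hd5
      · exact cell_nonneg_of_bernAuto_trunc wtopeELA slL11_nodup slL11_deg 2 47 290 (q := 128) (a := 528) (L := 29) (by norm_num) (by norm_num) (by norm_num) (by rw [phatopeELAs2_eq]; exact cellChk_opeELA_s2l6) (by norm_num; linarith) (by norm_num; linarith)
      rcases le_or_gt Δ ((357 : ℝ) / 32) with hd6 | hd6
      · exact cell_nonneg_of_bernAuto_trunc wtopeELA slL11_nodup slL11_deg 2 47 290 (q := 128) (a := 557) (L := 29) (by norm_num) (by norm_num) (by norm_num) (by rw [phatopeELAs2_eq]; exact cellChk_opeELA_s2l7) (by norm_num; linarith) (by norm_num; linarith)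
      rcases le_or_gt Δ ((193 : ℝ) / 16) with hd7 | hd7
      · exact cell_nonneg_of_bernAuto_trunc wtopeELA slL11_nodup slL11_deg 2 47 290 (q := 64) (a := 293) (L := 29) (by norm_num) (by norm_num) (by norm_num) (by rw [phatopeELAs2_eq]; exact cellChk_opeELA_s2l8) (by norm_num; linarith) (by norm_num; linarith)
      rcases le_or_gt Δ ((111 : ℝ) / 8) with hd8 | hd8
      · exact cell_nonneg_of_bernAuto_trunc wtopeELA slL11_nodup slL11_deg 2 47 290 (q := 32) (a := 161) (L := 29) (by norm_num) (by norm_num) (by norm_num) (by rw [phatopeELAs2_eq]; exact cellChk_opeELA_s2l9) (by norm_num; linarith) (by norm_num; linarith)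
      rcases le_or_gt Δ ((35 : ℝ) / 2) with hd9 | hd9
      · exact cell_nonneg_of_bernAuto_trunc wtopeELA slL11_nodup slL11_deg 2 47 290 (q := 16) (a := 95) (L := 29) (by norm_num) (by norm_num) (by norm_num) (by rw [phatopeELAs2_eq]; exact cellChk_opeELA_s2l10) (by norm_num; linarith) (by norm_num; linarith)
      exact cell_nonneg_of_bernAuto_trunc wtopeELA slL11_nodup slL11_deg 2 47 290 (q := 4) (a := 31) (L := 29) (by norm_num) (by norm_num) (by norm_num) (by rw [phatopeELAs2_eq]; exact cellChk_opeELA_s2l11) (by norm_num; linarith) (by norm_num; linarith)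
    · intro ℓ hℓ hℓ0 hℓ2 Δ hℓΔ hΔ
      have hℓR : (ℓ : ℝ) < 32 := lt_of_le_of_lt hℓΔ hΔ
      have hℓE : ℓ < 32 := by exact_mod_cast hℓR
      replace h2 := hΔ.le
      interval_cases ℓ
      · exact absurd rfl hℓ0
      · exact absurd hℓ (by decide)
      · exact absurd rfl hℓ2
      · exact absurd hℓ (by decide)
      · have h1 : (4 : ℝ) ≤ Δ := by exact_mod_cast hℓΔ
        refine ⟨39 + 1, by norm_num, ?_⟩
        rcases le_or_gt Δ ((23 : ℝ) / 4) with hd0 | hd0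
        · exact cell_nonneg_of_bernAuto_trunc wtopeELA slL11_nodup slL11_deg 4 39 235 (q := 8) (a := 0) (L := 7) (by norm_num) (by norm_num) (by norm_num) (by rw [phatopeELAs4_eq]; exact cellChk_opeELA_s4l0) (by norm_num; linarith) (by norm_num; linarith)
        rcases le_or_gt Δ ((15 : ℝ) / 2) with hd1 | hd1
        · exact cell_nonneg_of_bernAuto_trunc wtopeELA slL11_nodup slL11_deg 4 39 235 (q := 8) (a := 7) (L := 7) (by norm_num) (by norm_num) (by norm_num) (by rw [phatopeELAs4_eq]; exact cellChk_opeELA_s4l1) (by norm_num; linarith) (by norm_num; linarith)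
        rcases le_or_gt Δ ((67 : ℝ) / 8) with hd2 | hd2
        · exact cell_nonneg_of_bernAuto_trunc wtopeELA slL11_nodup slL11_deg 4 39 235 (q := 16) (a := 28) (L := 7) (by norm_num) (by norm_num) (by norm_num) (by rw [phatopeELAs4_eq]; exact cellChk_opeELA_s4l2) (by norm_num; linarith) (by norm_num; linarith)
        rcases le_or_gt Δ ((37 : ℝ) / 4) with hd3 | hd3
        · exact cell_nonneg_of_bernAuto_trunc wtopeELA slL11_nodup slL11_deg 4 39 235 (q := 16) (a := 35) (L := 7) (by norm_num) (by norm_num) (by norm_num) (by rw [phatopeELAs4_eq]; exact cellChk_opeELA_s4l3) (by norm_num; linarith) (by norm_num; linarith)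
        rcases le_or_gt Δ (11 : ℝ) with hd4 | hd4
        · exact cell_nonneg_of_bernAuto_trunc wtopeELA slL11_nodup slL11_deg 4 39 235 (q := 8) (a := 21) (L := 7) (by norm_num) (by norm_num) (by norm_num) (by rw [phatopeELAs4_eq]; exact cellChk_opeELA_s4l4) (by norm_num; linarith) (by norm_num; linarith)
        rcases le_or_gt Δ (18 : ℝ) with hd5 | hd5
        · exact cell_nonneg_of_bernAuto_trunc wtopeELA slL11_nodup slL11_deg 4 39 235 (q := 2) (a := 7) (L := 7) (by norm_num) (by norm_num) (by norm_num) (by rw [phatopeELAs4_eq]; exact cellChk_opeELA_s4l5) (by norm_num; linarith) (by norm_num; linarith)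
        exact cell_nonneg_of_bernAuto_trunc wtopeELA slL11_nodup slL11_deg 4 39 235 (q := 1) (a := 7) (L := 7) (by norm_num) (by norm_num) (by norm_num) (by rw [phatopeELAs4_eq]; exact cellChk_opeELA_s4l6) (by norm_num; linarith) (by norm_num; linarith)
      · exact absurd hℓ (by decide)
      · have h1 : (6 : ℝ) ≤ Δ := by exact_mod_cast hℓΔ
        refine ⟨39 + 1, by norm_num, ?_⟩
        exact cell_nonneg_of_bernAuto_trunc wtopeELA slL11_nodup slL11_deg 6 39 239 (q := 1) (a := 0) (L := 13) (by norm_num) (by norm_num) (by norm_num) (by rw [phatopeELAs6_eq]; exact cellChk_opeELA_s6l0) (by norm_num; linarith) (by norm_num; linarith)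
      · exact absurd hℓ (by decide)
      · have h1 : (8 : ℝ) ≤ Δ := by exact_mod_cast hℓΔ
        refine ⟨31 + 1, by norm_num, ?_⟩
        exact cell_nonneg_of_bernAuto_trunc wtopeELA slL11_nodup slL11_deg 8 31 187 (q := 1) (a := 0) (L := 12) (by norm_num) (by norm_num) (by norm_num) (by rw [phatopeELAs8_eq]; exact cellChk_opeELA_s8l0) (by norm_num; linarith) (by norm_num; linarith)
      · exact absurd hℓ (by decide)
      · have h1 : (10 : ℝ) ≤ Δ := by exact_mod_cast hℓΔ
        refine ⟨39 + 1, by norm_num, ?_⟩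
        exact cell_nonneg_of_bernAuto_trunc wtopeELA slL11_nodup slL11_deg 10 39 246 (q := 1) (a := 0) (L := 11) (by norm_num) (by norm_num) (by norm_num) (by rw [phatopeELAs10_eq]; exact cellChk_opeELA_s10l0) (by norm_num; linarith) (by norm_num; linarith)
      · exact absurd hℓ (by decide)
      · have h1 : (12 : ℝ) ≤ Δ := by exact_mod_cast hℓΔ
        refine ⟨39 + 1, by norm_num, ?_⟩
        exact cell_nonneg_of_bernAuto_trunc wtopeELA slL11_nodup slL11_deg 12 39 249 (q := 1) (a := 0) (L := 10) (by norm_num) (by norm_num) (by norm_num) (by rw [phatopeELAs12_eq]; exact cellChk_opeELA_s12l0) (by norm_num; linarith) (by norm_num; linarith)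
      · exact absurd hℓ (by decide)
      · have h1 : (14 : ℝ) ≤ Δ := by exact_mod_cast hℓΔ
        refine ⟨31 + 1, by norm_num, ?_⟩
        exact cell_nonneg_of_bernAuto_trunc wtopeELA slL11_nodup slL11_deg 14 31 195 (q := 1) (a := 0) (L := 9) (by norm_num) (by norm_num) (by norm_num) (by rw [phatopeELAs14_eq]; exact cellChk_opeELA_s14l0) (by norm_num; linarith) (by norm_num; linarith)
      · exact absurd hℓ (by decide)
      · have h1 : (16 : ℝ) ≤ Δ := by exact_mod_cast hℓΔ
        refine ⟨31 + 1, by norm_num, ?_⟩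
        exact cell_nonneg_of_bernAuto_trunc wtopeELA slL11_nodup slL11_deg 16 31 197 (q := 1) (a := 0) (L := 8) (by norm_num) (by norm_num) (by norm_num) (by rw [phatopeELAs16_eq]; exact cellChk_opeELA_s16l0) (by norm_num; linarith) (by norm_num; linarith)
      · exact absurd hℓ (by decide)
      · have h1 : (18 : ℝ) ≤ Δ := by exact_mod_cast hℓΔ
        refine ⟨31 + 1, by norm_num, ?_⟩
        exact cell_nonneg_of_bernAuto_trunc wtopeELA slL11_nodup slL11_deg 18 31 199 (q := 1) (a := 0) (L := 7) (by norm_num) (by norm_num) (by norm_num) (by rw [phatopeELAs18_eq]; exact cellChk_opeELA_s18l0) (by norm_num; linarith) (by norm_num; linarith)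
      · exact absurd hℓ (by decide)
      · have h1 : (20 : ℝ) ≤ Δ := by exact_mod_cast hℓΔ
        refine ⟨31 + 1, by norm_num, ?_⟩
        exact cell_nonneg_of_bernAuto_trunc wtopeELA slL11_nodup slL11_deg 20 31 201 (q := 1) (a := 0) (L := 6) (by norm_num) (by norm_num) (by norm_num) (by rw [phatopeELAs20_eq]; exact cellChk_opeELA_s20l0) (by norm_num; linarith) (by norm_num; linarith)
      · exact absurd hℓ (by decide)
      · have h1 : (22 : ℝ) ≤ Δ := by exact_mod_cast hℓΔ
        refine ⟨31 + 1, by norm_num, ?_⟩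
        exact cell_nonneg_of_bernAuto_trunc wtopeELA slL11_nodup slL11_deg 22 31 202 (q := 1) (a := 0) (L := 5) (by norm_num) (by norm_num) (by norm_num) (by rw [phatopeELAs22_eq]; exact cellChk_opeELA_s22l0) (by norm_num; linarith) (by norm_num; linarith)
      · exact absurd hℓ (by decide)
      · have h1 : (24 : ℝ) ≤ Δ := by exact_mod_cast hℓΔ
        refine ⟨31 + 1, by norm_num, ?_⟩
        exact cell_nonneg_of_bernAuto_trunc wtopeELA slL11_nodup slL11_deg 24 31 204 (q := 1) (a := 0) (L := 4) (by norm_num) (by norm_num) (by norm_num) (by rw [phatopeELAs24_eq]; exact cellChk_opeELA_s24l0) (by norm_num; linarith) (by norm_num; linarith)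
      · exact absurd hℓ (by decide)
      · have h1 : (26 : ℝ) ≤ Δ := by exact_mod_cast hℓΔ
        refine ⟨31 + 1, by norm_num, ?_⟩
        exact cell_nonneg_of_bernAuto_trunc wtopeELA slL11_nodup slL11_deg 26 31 205 (q := 1) (a := 0) (L := 3) (by norm_num) (by norm_num) (by norm_num) (by rw [phatopeELAs26_eq]; exact cellChk_opeELA_s26l0) (by norm_num; linarith) (by norm_num; linarith)
      · exact absurd hℓ (by decide)
      · have h1 : (28 : ℝ) ≤ Δ := by exact_mod_cast hℓΔ
        refine ⟨31 + 1, by norm_num, ?_⟩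
        exact cell_nonneg_of_bernAuto_trunc wtopeELA slL11_nodup slL11_deg 28 31 207 (q := 1) (a := 0) (L := 2) (by norm_num) (by norm_num) (by norm_num) (by rw [phatopeELAs28_eq]; exact cellChk_opeELA_s28l0) (by norm_num; linarith) (by norm_num; linarith)
      · exact absurd hℓ (by decide)
      · have h1 : (30 : ℝ) ≤ Δ := by exact_mod_cast hℓΔ
        refine ⟨31 + 1, by norm_num, ?_⟩
        exact cell_nonneg_of_bernAuto_trunc wtopeELA slL11_nodup slL11_deg 30 31 208 (q := 1) (a := 0) (L := 1) (by norm_num) (by norm_num) (by norm_num) (by rw [phatopeELAs30_eq]; exact cellChk_opeELA_s30l0) (by norm_num; linarith) (by norm_num; linarith)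
      · exact absurd hℓ (by decide)
  have hΛ : ∀ p ∈ slL11.toFinset, p.1 ≤ 11 ∧ p.2 ≤ 11 := by
    intro p hp
    have := slL11_deg p (List.mem_toFinset.mp hp)
    exact ⟨by omega, by omega⟩
  have hbox : ∀ Δ : ℝ, (197 / 200 : ℝ) ≤ Δ → Δ ≤ 20001 / 20000 →
      (2 : ℝ) ^ Δ * taylorFunctional2D (1 / 2) slL11.toFinset (fun p => (wtopeELA p : ℝ)) (crossF (1 / 8) (-1) (QN (79 + 1) 0 Δ)) +
          (1 / 2 : ℝ) ^ (1 / 8 : ℝ) * (1 / 2 : ℝ) ^ (1 / 8 : ℝ) * (2 * absWeight slL11.toFinset (fun p => (wtopeELA p : ℝ))) *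
            ((4 * tailMajor 11 (79 + 1 + 2)) * (2 * headMajor 11 (79 + 1) + 4 * tailMajor 11 (79 + 1 + 2))) ≤ -epsLowerMargin 11 79 (((((19700 : ℤ)) : ℝ) + (((301 : ℤ)) : ℝ)) / (((40000 : ℤ)) : ℝ)) ∧
      0 < taylorFunctional2D (1 / 2) slL11.toFinset (fun p => (wtopeELA p : ℝ)) (crossF (1 / 8) (-1) (fun _ _ => (1 : ℝ))) +
        (((124893 : ℕ) : ℝ) / ((2000000 : ℕ) : ℝ)) * ((2 : ℝ) ^ Δ * taylorFunctional2D (1 / 2) slL11.toFinset (fun p => (wtopeELA p : ℝ)) (crossF (1 / 8) (-1) (QN (79 + 1) 0 Δ))) := by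
    intro Δ h1 h2
    refine ⟨?_, ?_⟩
    · exact epsSignLower_of_bernAuto_truncZ wtopeELA slL11_nodup slL11_deg 79 586 (by norm_num) (q := 40000) (a := 19700) (L := 301) (by norm_num) (by norm_num) (by norm_num) (by norm_num) (by unfold epsLowerPolyZ; rw [phatopeELAs0_eq]; exact epsChkL_opeELA_l0) (by norm_num; linarith) (by norm_num; linarith)
    · exact epsIdent_of_bernAuto_trunc wtopeELA slL11_nodup slL11_deg 79 539 (Pn := 124893) (Pd := 2000000) (by norm_num) (q := 40000) (a := 19700) (L := 301) (by norm_num) (by norm_num) (by norm_num) (by unfold epsIdentPolyZ; rw [phatopeELAs0_eq]; exact epsChkI_opeELA_l0) (by norm_num; linarith) (by norm_num; linarith)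
  have h := opeEpsLower_half_of_cellsN slL11.toFinset (fun p => (wtopeELA p : ℝ)) (s := 1 / 8) (G := 2) (δ := 1) (E₀ := 32)
    (e₁ := 197 / 200) (e₂ := 20001 / 20000) (N := 79 + 1)
    (by norm_num) (by norm_num) (by norm_num) (by norm_num) (by norm_num) (by norm_num) (by norm_num) (by norm_num)
    (epsLowerMargin_pos 11 79 (by norm_num) (by norm_num)) hΛ (by norm_num) (by norm_num) hbox
    (region_of_kernelCertAuto wtopeELA slL11_nodup slL11_deg 11 12 (by norm_num) (by norm_num) PregopeELA_eq
      (by decide +kernel) QhatopeELA_eq _ cregopeELA_n0 cregJopeELA (by decide) cregJopeELA_ok) cells_opeELA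
  push_cast at h
  exact h

/-- **2D control, `λ²` two-sided, kernel-complete at Λ = 11**: `PBoxTwoSided (1/8) 2 1 (197/200) (20001/20000) (2^{197/200}·124893/2000000)
(2^{20001/20000}·127743/2000000)` — `pBoxTwoSided_rb6_L11` with BOTH hypotheses discharged by kernel replays (`opeEpsLower_2d_L11_opeELA` above,
`opeEpsUpper_2d_L11_opeEUA` of `Control2DL11OpeEUA`). CONTROL-ONLY (d = 2). [cite: RattazziEtAl2008, §5] -/
theorem pBoxTwoSided_2d_L11 :
    PBoxTwoSided (1 / 8) 2 1 (197 / 200) (20001 / 20000)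
      ((2 : ℝ) ^ (197 / 200 : ℝ) * (124893 / 2000000)) ((2 : ℝ) ^ (20001 / 20000 : ℝ) * (127743 / 2000000)) :=
  pBoxTwoSided_rb6_L11 opeEpsLower_2d_L11_opeELA opeEpsUpper_2d_L11_opeEUA

end Summit.CriticalPhenomena.Ising3D.Control2D
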